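import Mathlib.Combinatorics.SimpleGraph.LineGraph
import Literature.MathematicalPhysics.QuantumLattice.FlatBandFerromagnetismMielke
import HarnessLib

/-!
# Mielke's flat-band ferromagnetism on line graphs (kagomé-type lattices)

Topic `MathematicalPhysics/QuantumLattice` (Hubbard family; rigorous ferromagnetism). The line-graph
corollary of Mielke's general theorem (`FlatBandFerromagnetismMielke.lean`):
[Mielke 1991a; Mielke 1991b; Mielke 1992] as stated in [Tasaki 1998, §6.5, Theorem 6.2].

**Setting [Tasaki 1998, §6.5].** `G = (V, E)` a finite graph; its LINE GRAPH `L(G)` has vertex set `E`,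
two edges being adjacent iff they share a vertex. We describe `G` by an injective labelling
`ed : Λ → Sym2 V` of its edges by the sites `Λ` of `L(G)` (no loops: `¬ (ed l).IsDiag`); the graph is
`edGraph ed` and the line-graph hopping is `t_{ll'} = t` iff `l ≠ l'` and `ed l`, `ed l'` share a vertex
(`lineHopping`; = Mathlib's `SimpleGraph.lineGraph` adjacency, `lineHopping_eq_ite_lineGraph_adj`).
The Hubbard model on `L(G)` is
`H = t Σ_{{l,l'} ∈ E_L} Σ_σ (c†_{lσ}c_{l'σ} + c†_{l'σ}c_{lσ}) + U Σ_l n_{l↑}n_{l↓}`, `t > 0`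
(`lineGraphHamiltonian`, [Tasaki 1998, §6.5, the display defining `H` on `L(G)`]).

**Mechanism.** With the vertex–edge incidence vectors `u_v = 1_{v ∈ ed ·}` (`incVec`), the Gram
hopping `t Σ_v |u_v⟩⟨u_v|` is `t (A_{L(G)} + 2)` (`gramHopping_incVec`: two distinct edges share at
most one vertex), so `H = gramHamiltonian - 2t N̂` (`lineGraphHamiltonian_eq`) and the lowest band of
`L(G)` is FLAT at energy `-2t`; its eigenspace is the flat band `𝒦 = {f : Λ → ℝ | Σ_{l ∋ v} f(l) = 0 ∀ v}`
(`flatBand univ (incVec ed)`, the null space of the incidence matrix `B`, `BᵀB = A_{L(G)} + 2`). For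
connected bipartite `G` its dimension is `M(G) = |E| - |V| + 1` (`finrank_flatBand_incVec_add_card`:
rank–nullity for `B` and `Bᵀ`, `ker Bᵀ` = the alternating sign functions = one-dimensional).

**Theorem [Tasaki 1998, Theorem 6.2; Mielke 1991b] (`lineGraph_flatBand_ferromagnetism`).** If the flat
band of `L(G)` is irreducible in Mielke's sense, then for `N_e = dim 𝒦` and every `U > 0` the
ground-state energy of `H` is `-2t N_e`, every ground state has `S_tot = N_e/2`, and the ground states
are non-degenerate apart from the `(2 S_max + 1)`-fold degeneracy. The printed hypothesis "`G` is
twofold connected" enters Mielke's proof only through (a) every edge lies on an (even) cycle and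
(b) the cycles are connected through shared edges; we formalise exactly this content: an even cycle of
`G` carries an alternating flat-band vector which no coordinate splitting of `𝒦` can cut
(`cycleVec_mem_flatBand`, `cycleVec_subset_or_disjoint`), and a family of such indecomposable vectors
covering the support of `𝒦` with connected overlaps forces irreducibility (`isIrreducible_of_cover`,
a general lemma). `TODO(general form)`: derive (a), (b) from twofold connectedness (Whitney's theorem)
and the non-bipartite count `M(G) = |E| - |V|`.

## References

* H. Tasaki, Prog. Theor. Phys. **99** (1998) 489 = arXiv:cond-mat/9712219, §6.5, Theorem 6.2
  [Tasaki1998PTP] (held text p. 22).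
* A. Mielke, J. Phys. A **24** (1991) L73–L77 [Mielke1991a]; J. Phys. A **24** (1991) 3311–3321
  [Mielke1991b]; J. Phys. A **25** (1992) 4335–4345 (kagomé) [Mielke1992].
* A. Mielke, J. Phys. A **32** (1999) 8411 = arXiv:cond-mat/9910385, §4 [Mielke1999].
-/

noncomputable section

open Matrix Finset Module
open scoped ComplexOrder

namespace Literature.MathematicalPhysics.QuantumLattice

namespace FlatBand

variable {Λ : Type*} [LinearOrder Λ] [Fintype Λ]

/-! ### Shifting a Hamiltonian by a multiple of the particle number -/

section NumberShift

variable (H : Matrix (Finset (Orb Λ)) (Finset (Orb Λ)) ℂ) (c : ℝ)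

/-- An `N`-particle unit vector exists whenever `N ≤ 2|Λ|`. [folklore] -/
private theorem exists_isNParticle_unit_shift {N : ℕ} (hN : N ≤ Fintype.card (Orb Λ)) :
    ∃ ψ : Fock (Orb Λ), IsNParticle N ψ ∧ star ψ ⬝ᵥ ψ = 1 := by
  classical
  obtain ⟨s, -, hs⟩ := Finset.exists_subset_card_eq (s := (univ : Finset (Orb Λ))) (n := N)
    (by rw [card_univ]; exact hN)
  refine ⟨Pi.single s 1, fun v hv => ?_, ?_⟩
  · rw [Pi.single_eq_of_ne]
    rintro rfl
    exact hv hs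
  · simp [dotProduct, Pi.single_apply, apply_ite star]

/-- `⟨ψ, (H + cN̂)ψ⟩ = ⟨ψ, Hψ⟩ + cN` on unit `N`-particle vectors. [cite: Tasaki1998PTP, §3.1 (the
number operators commute with `H`; fixed electron number)] -/
theorem expect_add_smul_totalNumber {N : ℕ} {ψ : Fock (Orb Λ)} (hψN : IsNParticle N ψ)
    (hψ1 : star ψ ⬝ᵥ ψ = 1) :
    expect (H + (c : ℂ) • totalNumber) ψ = expect H ψ + (c : ℂ) * (N : ℂ) := by
  have hNψ : (totalNumber : Matrix (Finset (Orb Λ)) (Finset (Orb Λ)) ℂ) *ᵥ ψ = (N : ℂ) • ψ :=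
    (LiebTwo.isNParticle_iff_totalNumber N ψ).1 hψN
  unfold expect
  rw [add_mulVec, smul_mulVec, hNψ, dotProduct_add, dotProduct_smul, dotProduct_smul, hψ1, smul_eq_mul,
    smul_eq_mul, mul_one]

/-- Rayleigh intro rule: a uniform lower bound on the `N`-particle Rayleigh quotients bounds `E₀(H, N)`
from below (`N ≤ 2|Λ|`). [folklore] -/
private theorem le_groundEnergy_of_forall_re_expect {N : ℕ} (hN : N ≤ Fintype.card (Orb Λ)) {m : ℝ}
    (h : ∀ ψ : Fock (Orb Λ), IsNParticle N ψ → star ψ ⬝ᵥ ψ = 1 → m ≤ (expect H ψ).re) :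
    m ≤ groundEnergy H N := by
  obtain ⟨ψ₀, hψ₀N, hψ₀1⟩ := exists_isNParticle_unit_shift (Λ := Λ) hN
  unfold groundEnergy
  refine le_csInf ⟨_, ψ₀, hψ₀N, hψ₀1, rfl⟩ ?_
  rintro e ⟨ψ, hψN, hψ1, rfl⟩
  exact h ψ hψN hψ1

/-- **`E₀(H + cN̂, N) = E₀(H, N) + cN`** (`N ≤ 2|Λ|`). [cite: Tasaki1998PTP, §3.1 (fixed electron
number `N_e`)] -/
theorem groundEnergy_add_smul_totalNumber {N : ℕ} (hN : N ≤ Fintype.card (Orb Λ)) :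
    groundEnergy (H + (c : ℂ) • totalNumber) N = groundEnergy H N + c * N := by
  have hre : ∀ ψ : Fock (Orb Λ), IsNParticle N ψ → star ψ ⬝ᵥ ψ = 1 →
      (expect (H + (c : ℂ) • totalNumber) ψ).re = (expect H ψ).re + c * N := by
    intro ψ hψN hψ1
    rw [expect_add_smul_totalNumber H c hψN hψ1, Complex.add_re, ← Complex.ofReal_natCast,
      ← Complex.ofReal_mul, Complex.ofReal_re]
  have h1 : groundEnergy H N + c * N ≤ groundEnergy (H + (c : ℂ) • totalNumber) N :=
    le_groundEnergy_of_forall_re_expect _ hN fun ψ hψN hψ1 => by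
      rw [hre ψ hψN hψ1]
      have := LiebThm1.groundEnergy_le_re_expect H hψN hψ1
      linarith
  have h2 : groundEnergy (H + (c : ℂ) • totalNumber) N - c * N ≤ groundEnergy H N :=
    le_groundEnergy_of_forall_re_expect _ hN fun ψ hψN hψ1 => by
      have := LiebThm1.groundEnergy_le_re_expect (H + (c : ℂ) • totalNumber) hψN hψ1
      rw [hre ψ hψN hψ1] at this
      linarith
  linarith

/-- **Ground states are unchanged by a shift `cN̂`** (`N ≤ 2|Λ|`). [cite: Tasaki1998PTP, §3.1] -/
theorem isGroundState_add_smul_totalNumber_iff {N : ℕ} (hN : N ≤ Fintype.card (Orb Λ)) (ψ : Fock (Orb Λ)) :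
    IsGroundState (H + (c : ℂ) • totalNumber) N ψ ↔ IsGroundState H N ψ := by
  rw [IsGroundState, IsGroundState, groundEnergy_add_smul_totalNumber H c hN]
  refine and_congr_right fun hψN => and_congr_right fun _ => ?_
  have hNψ : (totalNumber : Matrix (Finset (Orb Λ)) (Finset (Orb Λ)) ℂ) *ᵥ ψ = (N : ℂ) • ψ :=
    (LiebTwo.isNParticle_iff_totalNumber N ψ).1 hψN
  rw [add_mulVec, smul_mulVec, hNψ, Complex.ofReal_add, add_smul, Complex.ofReal_mul,
    Complex.ofReal_natCast, smul_smul]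
  exact add_left_inj _

/-- The ground multiplet `ker(H' - E₀') ∩ {N̂ = N}` is unchanged by a shift `cN̂`. [cite: Tasaki1998PTP, §3.1] -/
theorem groundKer_add_smul_totalNumber {N : ℕ} (hN : N ≤ Fintype.card (Orb Λ)) :
    LinearMap.ker (Matrix.toLin' (H + (c : ℂ) • totalNumber -
          ((groundEnergy (H + (c : ℂ) • totalNumber) N : ℝ) : ℂ) • 1)) ⊓
        LinearMap.ker (Matrix.toLin' (totalNumber - (N : ℂ) • (1 : Matrix (Finset (Orb Λ)) _ ℂ))) =
      LinearMap.ker (Matrix.toLin' (H - ((groundEnergy H N : ℝ) : ℂ) • 1)) ⊓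
        LinearMap.ker (Matrix.toLin' (totalNumber - (N : ℂ) • (1 : Matrix (Finset (Orb Λ)) _ ℂ))) := by
  ext ψ
  simp only [Submodule.mem_inf, LinearMap.mem_ker, Matrix.toLin'_apply, sub_mulVec, smul_mulVec,
    one_mulVec, sub_eq_zero]
  constructor
  · rintro ⟨h1, h2⟩
    refine ⟨?_, h2⟩
    rw [groundEnergy_add_smul_totalNumber H c hN, add_mulVec, smul_mulVec, h2, smul_smul, Complex.ofReal_add,
      add_smul, Complex.ofReal_mul, Complex.ofReal_natCast] at h1
    exact add_right_cancel h1
  · rintro ⟨h1, h2⟩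
    refine ⟨?_, h2⟩
    rw [groundEnergy_add_smul_totalNumber H c hN, add_mulVec, smul_mulVec, h2, smul_smul, Complex.ofReal_add,
      add_smul, Complex.ofReal_mul, Complex.ofReal_natCast, h1]

end NumberShift

/-! ### Irreducibility from a cover by indecomposable flat-band vectors -/

section Cover

/-- **Irreducibility from a connected cover by indecomposable vectors.** Let `(f_j)_{j ∈ J}` be flat-band
vectors such that (α) no coordinate splitting of `𝒦` cuts the support of any `f_j`, (β) the supports are
connected through overlaps, and (γ) the supports cover every coordinate on which `𝒦` has weight. Then
`𝒦` is irreducible. (For line graphs the `f_j` are the alternating vectors of even cycles; (α)–(γ) is the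
content of "twofold connected" used in the proof.) [cite: Mielke1999, §4 (the set `{ψ_k}` does not decay
into two subsets with `ψ_k(x)ψ_{k'}(x) = 0` across)] [cite: Tasaki1998PTP, §6.5, Theorem 6.2 (hypothesis
"twofold connected")] -/
theorem isIrreducible_of_cover {K : Submodule ℝ (Λ → ℝ)} {J : Type*} (f : J → Λ → ℝ)
    (hα : ∀ j (S : Finset Λ), (∀ v ∈ K, cutoff S v ∈ K) →
      (∀ l, f j l ≠ 0 → l ∈ S) ∨ (∀ l, f j l ≠ 0 → l ∉ S))
    (hβ : ∀ j j', Relation.ReflTransGen (fun a b => ∃ l, f a l ≠ 0 ∧ f b l ≠ 0) j j')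
    (hγ : ∀ v ∈ K, ∀ l, v l ≠ 0 → ∃ j, f j l ≠ 0) :
    IsIrreducible K := by
  intro S hS
  by_cases hJ : ∃ j₀ l₀, f j₀ l₀ ≠ 0
  · obtain ⟨j₀, l₀, hj₀⟩ := hJ
    -- every `j` lies on the same side as `j₀`
    have hside : ∀ j, ((∀ l, f j l ≠ 0 → l ∈ S) ↔ (∀ l, f j₀ l ≠ 0 → l ∈ S)) ∨ (∀ l, f j l = 0) := by
      intro j
      have key : ∀ a b, Relation.ReflTransGen (fun a b => ∃ l, f a l ≠ 0 ∧ f b l ≠ 0) a b →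
          (∃ l, f a l ≠ 0) → ((∀ l, f b l ≠ 0 → l ∈ S) ↔ (∀ l, f a l ≠ 0 → l ∈ S)) := by
        intro a b h ha
        induction h with
        | refl => exact Iff.rfl
        | @tail b c _ hbc ih =>
          obtain ⟨l, hbl, hcl⟩ := hbc
          rw [← ih]
          rcases hα b S hS with hb | hb <;> rcases hα c S hS with hc | hc
          · exact ⟨fun _ => hb, fun _ => hc⟩
          · exact absurd (hb l hbl) (hc l hcl)
          · exact absurd (hc l hcl) (hb l hbl)
          · constructor
            · intro h' l' hl'; exact absurd (h' l hcl) (hc l hcl)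
            · intro h' l' hl'; exact absurd (h' l hbl) (hb l hbl)
      by_cases hj : ∃ l, f j l ≠ 0
      · exact Or.inl ((key j₀ j (hβ j₀ j) ⟨l₀, hj₀⟩))
      · push Not at hj
        exact Or.inr hj
    rcases hα j₀ S hS with h₀ | h₀
    · -- everything inside `S`: `𝒦` vanishes off `S`
      right
      intro v hv l hl
      by_contra hvl
      obtain ⟨j, hj⟩ := hγ v hv l hvl
      rcases hside j with hj' | hj'
      · exact hl ((hj'.2 h₀) l hj)
      · exact hj (hj' l)
    · left
      intro v hv l hl
      by_contra hvl
      obtain ⟨j, hj⟩ := hγ v hv l hvl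
      rcases hside j with hj' | hj'
      · rcases hα j S hS with h1 | h1
        · exact h₀ l₀ hj₀ ((hj'.1 h1) l₀ hj₀)
        · exact h1 l hj hl
      · exact hj (hj' l)
  · -- no vector at all: `𝒦` has no weight anywhere
    push Not at hJ
    left
    intro v hv l _
    by_contra hvl
    obtain ⟨j, hj⟩ := hγ v hv l hvl
    exact hj (hJ j l)

end Cover

/-! ### Line graphs: incidence vectors, the flat band at `-2t`, and the Hubbard Hamiltonian -/

section LineGraph

variable {V : Type*} [Fintype V] [DecidableEq V] (ed : Λ → Sym2 V) (t U : ℝ)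

/-- The vertex–edge incidence vector of the vertex `v`: `u_v(l) = 1` if `v ∈ ed l`, else `0` (the rows of
the incidence matrix `B` of `G`, `BᵀB = A_{L(G)} + 2`). [cite: Tasaki1998PTP, §6.5 (construction of the
line graph: "two vertices `x,y ∈ V_L` are adjacent … if the corresponding two edges … share a common
vertex")] -/
def incVec (v : V) : Λ → ℝ := fun l => if v ∈ ed l then 1 else 0

/-- The graph `G = (V, E)` described by the edge labelling `ed`: `v ∼ w` iff `v ≠ w` and `s(v,w)` is a
labelled edge. [cite: Tasaki1998PTP, §6.5 ("Let `G = (V,E)` be an abstract graph")] -/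
def edGraph : SimpleGraph V := SimpleGraph.fromRel fun v w => ∃ l, ed l = s(v, w)

/-- The line-graph hopping `t_{ll'} = t` iff `l ≠ l'` and the edges `ed l`, `ed l'` share a vertex.
[cite: Tasaki1998PTP, §6.5 (definition of `L(G) = (V_L, E_L)` and of `H` with constant `t > 0`)] -/
def lineHopping : Λ → Λ → ℝ := fun l l' => if l ≠ l' ∧ ∃ v, v ∈ ed l ∧ v ∈ ed l' then t else 0

/-- **The Hubbard model on the line graph**,
`H = t Σ_{{l,l'} ∈ E_L} Σ_σ (c†_{lσ}c_{l'σ} + c†_{l'σ}c_{lσ}) + U Σ_l n_{l↑}n_{l↓}` (ordered pairs in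
`hoppingOp` produce both terms). [cite: Tasaki1998PTP, §6.5 (the display defining `H` on `L(G)`)] -/
def lineGraphHamiltonian : Matrix (Finset (Orb Λ)) (Finset (Orb Λ)) ℂ :=
  hoppingOp (lineHopping ed t) + (U : ℂ) • onSiteRepulsion

variable {ed}

omit [LinearOrder Λ] [Fintype Λ] [Fintype V] [DecidableEq V] in
/-- Every non-diagonal unordered pair has two distinct representatives. [folklore] -/
private theorem exists_eq_mk_of_not_isDiag {e : Sym2 V} (he : ¬ e.IsDiag) : ∃ a b, a ≠ b ∧ e = s(a, b) := by
  induction e using Sym2.ind with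
  | h a b => exact ⟨a, b, fun h => he (Sym2.mk_isDiag_iff.2 h), rfl⟩

omit [LinearOrder Λ] [Fintype Λ] [Fintype V] [DecidableEq V] in
/-- Adjacency of `edGraph`. [cite: Tasaki1998PTP, §6.5] -/
theorem edGraph_adj_iff {v w : V} : (edGraph ed).Adj v w ↔ v ≠ w ∧ ∃ l, ed l = s(v, w) := by
  rw [edGraph, SimpleGraph.fromRel_adj]
  refine and_congr_right fun _ => ?_
  constructor
  · rintro (h | ⟨l, hl⟩)
    · exact h
    · exact ⟨l, by rw [hl, Sym2.eq_swap]⟩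
  · exact fun h => Or.inl h

omit [LinearOrder Λ] [Fintype Λ] [Fintype V] [DecidableEq V] in
/-- A labelled non-loop edge is an edge of `edGraph`. [cite: Tasaki1998PTP, §6.5] -/
theorem ed_mem_edgeSet (hnd : ∀ l, ¬ (ed l).IsDiag) (l : Λ) : ed l ∈ (edGraph ed).edgeSet := by
  obtain ⟨a, b, hab, hl⟩ := exists_eq_mk_of_not_isDiag (hnd l)
  rw [hl, SimpleGraph.mem_edgeSet, edGraph_adj_iff]
  exact ⟨hab, l, hl⟩

omit [Fintype Λ] in
open scoped Classical in
/-- `lineHopping` is `t` times the adjacency of Mathlib's `SimpleGraph.lineGraph` of `edGraph ed`,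
transported along the injective labelling `ed`. [cite: Tasaki1998PTP, §6.5 (definition of `L(G)`)] -/
theorem lineHopping_eq_ite_lineGraph_adj (hnd : ∀ l, ¬ (ed l).IsDiag) (hinj : Function.Injective ed)
    (l l' : Λ) :
    lineHopping ed t l l' =
      if (edGraph ed).lineGraph.Adj ⟨ed l, ed_mem_edgeSet hnd l⟩ ⟨ed l', ed_mem_edgeSet hnd l'⟩
      then t else 0 := by
  rw [lineHopping]
  have key : (l ≠ l' ∧ ∃ v, v ∈ ed l ∧ v ∈ ed l') ↔
      (edGraph ed).lineGraph.Adj ⟨ed l, ed_mem_edgeSet hnd l⟩ ⟨ed l', ed_mem_edgeSet hnd l'⟩ := by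
    rw [SimpleGraph.lineGraph_adj_iff_exists]
    refine and_congr_left fun _ => ?_
    rw [Ne, Ne, Subtype.mk.injEq, hinj.eq_iff]
  by_cases h : l ≠ l' ∧ ∃ v, v ∈ ed l ∧ v ∈ ed l'
  · rw [if_pos h, if_pos (key.1 h)]
  · rw [if_neg h, if_neg (fun h' => h (key.2 h'))]

omit [Fintype Λ] in
/-- The number of common vertices of two labelled edges: `2` if equal, `1` if adjacent in the line graph,
`0` otherwise (two distinct edges share at most one vertex). [cite: Tasaki1998PTP, §6.5] -/
theorem sum_incVec_mul_incVec (hnd : ∀ l, ¬ (ed l).IsDiag) (hinj : Function.Injective ed) (l l' : Λ) :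
    ∑ v, incVec ed v l * incVec ed v l' =
      if l = l' then 2 else if ∃ v, v ∈ ed l ∧ v ∈ ed l' then 1 else 0 := by
  have hind : ∀ v, incVec ed v l * incVec ed v l' = if v ∈ ed l ∧ v ∈ ed l' then 1 else 0 := by
    intro v
    simp only [incVec]
    split_ifs <;> simp_all
  simp_rw [hind]
  rw [Finset.sum_boole]
  obtain ⟨a, b, hab, hl⟩ := exists_eq_mk_of_not_isDiag (hnd l)
  by_cases hll : l = l'
  · subst hll
    rw [if_pos rfl]
    have : (univ.filter fun v => v ∈ ed l ∧ v ∈ ed l) = {a, b} := by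
      ext v; simp [hl, Sym2.mem_iff]
    rw [this, card_pair hab]
    norm_num
  · rw [if_neg hll]
    by_cases hsh : ∃ v, v ∈ ed l ∧ v ∈ ed l'
    · rw [if_pos hsh]
      obtain ⟨v, hv, hv'⟩ := hsh
      have : (univ.filter fun w => w ∈ ed l ∧ w ∈ ed l') = {v} := by
        ext w
        simp only [mem_filter, mem_univ, true_and, mem_singleton]
        constructor
        · rintro ⟨hw, hw'⟩
          by_contra hwv
          exact hll (hinj (Sym2.eq_of_ne_mem hwv hw hv hw' hv'))
        · rintro rfl; exact ⟨hv, hv'⟩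
      rw [this, card_singleton]
      norm_num
    · rw [if_neg hsh]
      have : (univ.filter fun w => w ∈ ed l ∧ w ∈ ed l') = ∅ := by
        rw [Finset.filter_eq_empty_iff]
        intro w _ hw
        exact hsh ⟨w, hw⟩
      rw [this, card_empty]
      norm_num

omit [Fintype Λ] in
/-- **`BᵀB = A_{L(G)} + 2`**: the Gram hopping of the incidence vectors is the line-graph hopping plus the
constant on-site term `2t`. [cite: Tasaki1998PTP, §6.5] [cite: Mielke1991b] -/
theorem gramHopping_incVec (hnd : ∀ l, ¬ (ed l).IsDiag) (hinj : Function.Injective ed) (l l' : Λ) :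
    gramHopping (univ : Finset V) (incVec ed) t l l' =
      lineHopping ed t l l' + (if l = l' then 2 * t else 0) := by
  rw [gramHopping, sum_incVec_mul_incVec hnd hinj, lineHopping]
  by_cases hll : l = l'
  · rw [if_pos hll, if_neg (fun h => h.1 hll), if_pos hll]; ring
  · rw [if_neg hll, if_neg hll, add_zero]
    by_cases hsh : ∃ v, v ∈ ed l ∧ v ∈ ed l'
    · rw [if_pos hsh, if_pos ⟨hll, hsh⟩]; ring
    · rw [if_neg hsh, if_neg (fun h => hsh h.2)]; ring

/-- `hoppingOp` is additive in the hopping matrix. [cite: Tasaki1998PTP, §2.4 (`H_hop = Σ t_{xy} c†c`)] -/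
theorem hoppingOp_add (T T' : Λ → Λ → ℝ) : hoppingOp (T + T') = hoppingOp T + hoppingOp T' := by
  rw [hoppingOp, hoppingOp, hoppingOp, ← sum_add_distrib]
  refine sum_congr rfl fun x _ => ?_
  rw [← sum_add_distrib]
  refine sum_congr rfl fun y _ => ?_
  rw [← sum_add_distrib]
  refine sum_congr rfl fun σ _ => ?_
  rw [Pi.add_apply, Pi.add_apply, Complex.ofReal_add, add_smul]

/-- A constant diagonal hopping is a multiple of the particle number:
`Σ_{x,y,σ} c δ_{xy} c†_{xσ}c_{yσ} = c N̂`. [cite: Tasaki1998PTP, §2.5 (number operators)] -/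
theorem hoppingOp_diagonal_const (c : ℝ) :
    hoppingOp (fun x y : Λ => if x = y then c else 0) = (c : ℂ) • totalNumber := by
  rw [hoppingOp, totalNumber, Finset.smul_sum]
  refine sum_congr rfl fun x _ => ?_
  rw [Finset.sum_eq_single x, Finset.smul_sum]
  · refine sum_congr rfl fun σ _ => ?_
    rw [if_pos rfl, numberOp]
  · intro y _ hyx
    refine sum_eq_zero fun σ _ => ?_
    rw [if_neg (Ne.symm hyx), Complex.ofReal_zero, zero_smul]
  · intro h; exact absurd (mem_univ x) h

/-- **`H_{L(G)} = H_Gram - 2t N̂`**: the line-graph Hubbard Hamiltonian is the Gram Hamiltonian of the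
incidence vectors shifted by `-2t N̂` (the flat band of `L(G)` sits at `-2t`). [cite: Tasaki1998PTP, §6.5]
[cite: Mielke1991b] -/
theorem lineGraphHamiltonian_eq (hnd : ∀ l, ¬ (ed l).IsDiag) (hinj : Function.Injective ed) :
    lineGraphHamiltonian ed t U =
      gramHamiltonian (univ : Finset V) (incVec ed) t U + ((-(2 * t) : ℝ) : ℂ) • totalNumber := by
  have hT : gramHopping (univ : Finset V) (incVec ed) t =
      lineHopping ed t + fun x y : Λ => if x = y then 2 * t else 0 := by
    funext l l'
    rw [Pi.add_apply, Pi.add_apply, gramHopping_incVec t hnd hinj]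
  rw [lineGraphHamiltonian, gramHamiltonian, hT, hoppingOp_add, hoppingOp_diagonal_const,
    Complex.ofReal_neg, neg_smul]
  abel

omit [LinearOrder Λ] in
/-- The flat band of the incidence family is the space of edge functions with vanishing vertex sums
(`Σ_{l ∋ v} f(l) = 0` for every vertex `v`), i.e. the null space of the incidence matrix.
[cite: Mielke1991b] [cite: Tasaki1998PTP, §6.5] -/
theorem mem_flatBand_incVec_iff (f : Λ → ℝ) :
    f ∈ flatBand (univ : Finset V) (incVec ed) ↔ ∀ v, ∑ l, (if v ∈ ed l then f l else 0) = 0 := by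
  rw [mem_flatBand]
  simp only [mem_univ, true_implies, dotProduct, incVec]
  refine forall_congr' fun v => ?_
  have : ∀ l, (if v ∈ ed l then (1 : ℝ) else 0) * f l = if v ∈ ed l then f l else 0 := by
    intro l; split_ifs <;> simp
  simp_rw [this]

/-! ### The theorem -/

variable {t U}

/-- **Mielke's flat-band ferromagnetism on line graphs** [Tasaki 1998, Theorem 6.2; Mielke 1991a,b].
For the Hubbard model on the line graph `L(G)` (`ed` an injective labelling of the edges of `G` by the
sites `Λ`, no loops) with `t > 0`, `U > 0` and `N_e = dim 𝒦` electrons, `𝒦` the flat band of `L(G)`: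
if `𝒦` is irreducible (Mielke; implied by `G` twofold connected, see `isIrreducible_of_cover` with the
cycle vectors below), then the ground-state energy is `-2t N_e`, every ground state has
`S_tot = S_max = N_e/2` (`S² ψ = S_max(S_max+1) ψ`), and the ground states are non-degenerate apart from
the trivial `(2S_max + 1)`-fold degeneracy (ground multiplet of dimension exactly `N_e + 1`).
[cite: Tasaki1998PTP, §6.5, Theorem 6.2] [cite: Mielke1991b] [cite: Mielke1999, §4] -/
theorem lineGraph_flatBand_ferromagnetism (hnd : ∀ l, ¬ (ed l).IsDiag) (hinj : Function.Injective ed)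
    (ht : 0 < t) (hU : 0 < U) (hirr : IsIrreducible (flatBand (univ : Finset V) (incVec ed))) :
    groundEnergy (lineGraphHamiltonian ed t U) (finrank ℝ (flatBand (univ : Finset V) (incVec ed))) =
        -(2 * t) * finrank ℝ (flatBand (univ : Finset V) (incVec ed)) ∧
      (∀ ψ : Fock (Orb Λ), IsGroundState (lineGraphHamiltonian ed t U)
          (finrank ℝ (flatBand (univ : Finset V) (incVec ed))) ψ →
        spinSq *ᵥ ψ = ((((finrank ℝ (flatBand (univ : Finset V) (incVec ed)) : ℝ) / 2) *
          ((finrank ℝ (flatBand (univ : Finset V) (incVec ed)) : ℝ) / 2 + 1) : ℝ) : ℂ) • ψ) ∧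
      Module.finrank ℂ ↥(LinearMap.ker (Matrix.toLin' (lineGraphHamiltonian ed t U -
          ((groundEnergy (lineGraphHamiltonian ed t U)
            (finrank ℝ (flatBand (univ : Finset V) (incVec ed))) : ℝ) : ℂ) • 1)) ⊓
        LinearMap.ker (Matrix.toLin' (totalNumber -
          (finrank ℝ (flatBand (univ : Finset V) (incVec ed)) : ℂ) • (1 : Matrix (Finset (Orb Λ)) _ ℂ)))) =
        finrank ℝ (flatBand (univ : Finset V) (incVec ed)) + 1 := by
  set N := finrank ℝ (flatBand (univ : Finset V) (incVec ed)) with hN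
  obtain ⟨h1, h2, h3⟩ := mielke_flatBand_ferromagnetism (univ : Finset V) (incVec ed) ht hU hirr
  rw [← hN] at h1 h2 h3
  -- the flat band fits into the orbitals: `N ≤ |Λ| ≤ 2|Λ|`
  have hNle : N ≤ Fintype.card (Orb Λ) := by
    have h := Submodule.finrank_le (flatBand (univ : Finset V) (incVec ed))
    rw [Module.finrank_fintype_fun_eq_card] at h
    have : Fintype.card Λ ≤ Fintype.card (Orb Λ) := by
      rw [show Fintype.card (Orb Λ) = Fintype.card Λ * 2 by simp [Orb, Fintype.card_prod]]
      omega
    exact h.trans this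
  rw [lineGraphHamiltonian_eq t U hnd hinj]
  refine ⟨?_, fun ψ hψ => h2 ψ ((isGroundState_add_smul_totalNumber_iff _ _ hNle ψ).1 hψ), ?_⟩
  · rw [groundEnergy_add_smul_totalNumber _ _ hNle, h1]; ring
  · rw [groundKer_add_smul_totalNumber _ _ hNle]; exact h3

/-! ### Even cycles: indecomposable flat-band vectors -/

/-- The alternating vector of a cycle of labelled edges `c : ZMod n → Λ` with signs `s`:
`f = Σ_i s_i δ_{c_i}`. [cite: Mielke1991b] [cite: Tasaki1998PTP, §6.5 (Theorem 6.2, the kagomé example: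
flat-band states localised on hexagons)] -/
def cycleVec {n : ℕ} [NeZero n] (c : ZMod n → Λ) (s : ZMod n → ℝ) : Λ → ℝ :=
  fun l => ∑ i, if c i = l then s i else 0

variable {n : ℕ} [NeZero n] {p : ZMod n → V} {c : ZMod n → Λ} {s : ZMod n → ℝ}

omit [Fintype Λ] in
/-- On the cycle, `f(c_i) = s_i` (injective `c`). [cite: Mielke1991b] -/
theorem cycleVec_apply_cycle (hc : Function.Injective c) (i : ZMod n) : cycleVec c s (c i) = s i := by
  rw [cycleVec, Finset.sum_eq_single i]
  · rw [if_pos rfl]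
  · intro j _ hji; rw [if_neg (fun h => hji (hc h))]
  · intro h; exact absurd (mem_univ i) h

omit [Fintype Λ] in
/-- Off the cycle, `f = 0`. [cite: Mielke1991b] -/
theorem cycleVec_apply_of_notMem {l : Λ} (hl : ∀ i, c i ≠ l) : cycleVec c s l = 0 := by
  rw [cycleVec]
  exact sum_eq_zero fun i _ => if_neg (hl i)

omit [LinearOrder Λ] [Fintype Λ] [Fintype V] [DecidableEq V] [NeZero n] in
/-- The cycle edges at the vertex `p_j` are exactly `c_{j-1}` and `c_j` (injective `p`, `n ≥ 3`).
[cite: Tasaki1998PTP, §6.5] -/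
private theorem mem_ed_cycle_iff (hed : ∀ i, ed (c i) = s(p i, p (i + 1))) (hp : Function.Injective p)
    (j i : ZMod n) : p j ∈ ed (c i) ↔ i = j ∨ i = j - 1 := by
  rw [hed i, Sym2.mem_iff, hp.eq_iff, hp.eq_iff]
  constructor
  · rintro (h | h)
    · exact Or.inl h.symm
    · exact Or.inr (by rw [h]; ring)
  · rintro (rfl | rfl)
    · exact Or.inl rfl
    · exact Or.inr (by ring)

omit [Fintype V] in
/-- The vertex sum of a cycle-supported function `g` (i.e. `g = 0` off the cycle) at the cycle vertex
`p_j` is `g(c_j) + g(c_{j-1})`; at a vertex off the cycle it vanishes. [cite: Tasaki1998PTP, §6.5] -/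
private theorem vertexSum_of_cycleSupported (hed : ∀ i, ed (c i) = s(p i, p (i + 1)))
    (hp : Function.Injective p) (hc : Function.Injective c) (hn : 3 ≤ n) {g : Λ → ℝ}
    (hg : ∀ l, (∀ i, c i ≠ l) → g l = 0) (v : V) :
    ∑ l, (if v ∈ ed l then g l else 0) =
      if h : ∃ j, p j = v then g (c h.choose) + g (c (h.choose - 1)) else 0 := by
  classical
  -- restrict the sum to the cycle
  have hrestrict : ∑ l, (if v ∈ ed l then g l else 0) = ∑ i, (if v ∈ ed (c i) then g (c i) else 0) := by
    rw [← Finset.sum_image (f := fun l => if v ∈ ed l then g l else 0) (s := univ) (g := c)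
      (fun i _ j _ h => hc h)]
    symm
    apply Finset.sum_subset (subset_univ _)
    intro l _ hl
    have hl' : ∀ i, c i ≠ l := fun i h => hl (mem_image.2 ⟨i, mem_univ i, h⟩)
    rw [hg l hl']; simp
  rw [hrestrict]
  split_ifs with h
  · have hjc : p h.choose = v := h.choose_spec
    have hmem : ∀ i, v ∈ ed (c i) ↔ i = h.choose ∨ i = h.choose - 1 := fun i => by
      rw [← mem_ed_cycle_iff hed hp h.choose i, hjc]
    simp_rw [hmem]
    have hne : h.choose ≠ h.choose - 1 := by
      haveI : Fact (1 < n) := ⟨by omega⟩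
      intro h'
      have h1 : (1 : ZMod n) = 0 := by linear_combination h'
      exact one_ne_zero h1
    rw [Finset.sum_ite, Finset.sum_const_zero, add_zero]
    have : (univ.filter fun i : ZMod n => i = h.choose ∨ i = h.choose - 1) = {h.choose, h.choose - 1} := by
      ext i; simp
    rw [this, Finset.sum_pair hne]
  · push Not at h
    refine Finset.sum_eq_zero fun i _ => ?_
    rw [if_neg]
    rw [hed i, Sym2.mem_iff, not_or]
    exact ⟨fun h' => h i h'.symm, fun h' => h (i + 1) h'.symm⟩

/-- **The alternating vector of an even cycle lies in the flat band**: at each cycle vertex the two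
cycle edges carry opposite signs (`s_{i+1} = -s_i`; consistency around the cycle forces even length).
[cite: Mielke1991b] [cite: Tasaki1998PTP, §6.5] -/
theorem cycleVec_mem_flatBand (hed : ∀ i, ed (c i) = s(p i, p (i + 1))) (hp : Function.Injective p)
    (hc : Function.Injective c) (hn : 3 ≤ n) (hs : ∀ i, s (i + 1) = -s i) :
    cycleVec c s ∈ flatBand (univ : Finset V) (incVec ed) := by
  rw [mem_flatBand_incVec_iff]
  intro v
  rw [vertexSum_of_cycleSupported hed hp hc hn (fun l hl => cycleVec_apply_of_notMem hl) v]
  split_ifs with h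
  · rw [cycleVec_apply_cycle hc, cycleVec_apply_cycle hc]
    have := hs (h.choose - 1)
    rw [sub_add_cancel] at this
    rw [this]; ring
  · rfl

/-- **An even cycle cannot be cut by a coordinate splitting of the flat band**: if the cut-off of the
cycle vector to `S` is again in the flat band, then the cycle lies inside `S` or avoids `S` (at a cycle
vertex a single surviving cycle edge would have nonzero vertex sum; then propagate around the cycle).
[cite: Mielke1991b] [cite: Mielke1999, §4] -/
theorem cycleVec_subset_or_disjoint (hed : ∀ i, ed (c i) = s(p i, p (i + 1))) (hp : Function.Injective p)
    (hc : Function.Injective c) (hn : 3 ≤ n) (hs : ∀ i, s (i + 1) = -s i) (hs0 : ∀ i, s i ≠ 0)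
    {S : Finset Λ} (hS : cutoff S (cycleVec c s) ∈ flatBand (univ : Finset V) (incVec ed)) :
    (∀ l, cycleVec c s l ≠ 0 → l ∈ S) ∨ (∀ l, cycleVec c s l ≠ 0 → l ∉ S) := by
  classical
  rw [mem_flatBand_incVec_iff] at hS
  -- consecutive cycle edges are on the same side
  have hstep : ∀ j : ZMod n, (c j ∈ S ↔ c (j - 1) ∈ S) := by
    intro j
    have h := hS (p j)
    rw [vertexSum_of_cycleSupported hed hp hc hn (g := cutoff S (cycleVec c s)) (fun l hl => by
      simp only [cutoff_apply, cycleVec_apply_of_notMem hl, ite_self]) (p j)] at h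
    have hex : ∃ j', p j' = p j := ⟨j, rfl⟩
    rw [dif_pos hex] at h
    have hj : hex.choose = j := hp hex.choose_spec
    simp only [hj, cutoff_apply, cycleVec_apply_cycle hc] at h
    have hsj : s j = -s (j - 1) := by
      have := hs (j - 1); rwa [sub_add_cancel] at this
    by_cases h1 : c j ∈ S <;> by_cases h2 : c (j - 1) ∈ S
    · exact ⟨fun _ => h2, fun _ => h1⟩
    · rw [if_pos h1, if_neg h2, add_zero] at h
      exact absurd h (hs0 j)
    · rw [if_neg h1, if_pos h2, zero_add] at h
      exact absurd h (hs0 (j - 1))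
    · exact ⟨fun h' => absurd h' h1, fun h' => absurd h' h2⟩
  -- propagate: every cycle edge is on the side of `c 0`
  have hall : ∀ k : ℕ, (c (k : ZMod n) ∈ S ↔ c 0 ∈ S) := by
    intro k
    induction k with
    | zero => simp
    | succ k ih =>
      rw [← ih]
      have := hstep ((k + 1 : ℕ) : ZMod n)
      rw [this]
      push_cast
      rw [add_sub_cancel_right]
  have hall' : ∀ i : ZMod n, (c i ∈ S ↔ c 0 ∈ S) := by
    intro i
    have := hall i.val
    rwa [ZMod.natCast_zmod_val] at this
  -- the support of the cycle vector is the cycle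
  have hsupp : ∀ l, cycleVec c s l ≠ 0 → ∃ i, c i = l := by
    intro l hl
    by_contra h
    push Not at h
    exact hl (cycleVec_apply_of_notMem h)
  by_cases h0 : c 0 ∈ S
  · left
    intro l hl
    obtain ⟨i, rfl⟩ := hsupp l hl
    exact (hall' i).2 h0
  · right
    intro l hl
    obtain ⟨i, rfl⟩ := hsupp l hl
    exact fun h => h0 ((hall' i).1 h)

/-! ### The flat-band dimension `M(G) = |E| - |V| + 1` for connected bipartite `G` -/

omit [LinearOrder Λ] in
/-- The flat band is the kernel of the incidence matrix (as a linear map `ℝ^Λ → ℝ^V`).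
[cite: Mielke1991b] -/
theorem flatBand_incVec_eq_ker :
    flatBand (univ : Finset V) (incVec ed) =
      LinearMap.ker (Matrix.of fun v l => incVec ed v l).mulVecLin := by
  ext f
  rw [LinearMap.mem_ker, Matrix.mulVecLin_apply, mem_flatBand]
  constructor
  · intro h
    funext v
    simpa [Matrix.mulVec] using h v (mem_univ v)
  · intro h v _
    have := congrFun h v
    simpa [Matrix.mulVec] using this

omit [LinearOrder Λ] [Fintype Λ] in
/-- The transposed incidence matrix maps a vertex function `g` to the edge function
`l ↦ g(a) + g(b)`, `ed l = s(a,b)`. [cite: Mielke1991b] -/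
theorem transpose_incidence_mulVec {g : V → ℝ} {l : Λ} {a b : V} (hab : a ≠ b) (hl : ed l = s(a, b)) :
    ((Matrix.of fun v l => incVec ed v l)ᵀ *ᵥ g) l = g a + g b := by
  rw [Matrix.mulVec, dotProduct]
  simp only [Matrix.transpose_apply, Matrix.of_apply, incVec, hl, Sym2.mem_iff]
  have : ∀ v, (if v = a ∨ v = b then (1 : ℝ) else 0) * g v =
      (if v = a then g v else 0) + (if v = b then g v else 0) := by
    intro v
    by_cases hva : v = a
    · subst hva; simp [hab]
    · by_cases hvb : v = b
      · subst hvb; simp [hva]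
      · simp [hva, hvb]
  simp_rw [this]
  rw [sum_add_distrib, Finset.sum_ite_eq' univ a, Finset.sum_ite_eq' univ b, if_pos (mem_univ a),
    if_pos (mem_univ b)]

omit [LinearOrder Λ] [Fintype Λ] [Fintype V] [DecidableEq V] in
/-- Along a walk of `edGraph`, a vertex function in the kernel of the transposed incidence matrix
alternates: `g(w)/ε(w) = g(v)/ε(v)` for an alternating `ε`. [folklore] -/
private theorem ker_transpose_walk {ε g : V → ℝ} (hε : ∀ v w, (edGraph ed).Adj v w → ε v = -ε w)
    (hg : ∀ v w, (edGraph ed).Adj v w → g v = -g w) {v w : V}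
    (q : (edGraph ed).Walk v w) : g w * ε v = g v * ε w := by
  induction q with
  | nil => rfl
  | @cons a b b' hadj q ih =>
    have h1 := hε a b hadj
    have h2 := hg a b hadj
    rw [h1, h2]
    linear_combination -ih

omit [LinearOrder Λ] in
/-- **`M(G) = |E| - |V| + 1` for connected bipartite `G`**: the flat band of the line graph of a
connected graph admitting an alternating nonvanishing vertex function `ε` (bipartite) has dimension
`|Λ| - |V| + 1` (rank–nullity for the incidence matrix; the kernel of its transpose is spanned by `ε`).
[cite: Tasaki1998PTP, §6.5 ("we set `M(G) = |E| - |V| + 1` if `G` is bipartite")] [cite: Mielke1991b] -/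
theorem finrank_flatBand_incVec_add_card (hnd : ∀ l, ¬ (ed l).IsDiag) (hconn : (edGraph ed).Connected)
    {ε : V → ℝ} (hε : ∀ v w, (edGraph ed).Adj v w → ε v = -ε w) (hε0 : ∀ v, ε v ≠ 0) :
    finrank ℝ (flatBand (univ : Finset V) (incVec ed)) + Fintype.card V = Fintype.card Λ + 1 := by
  classical
  set M : Matrix V Λ ℝ := Matrix.of fun v l => incVec ed v l with hM
  -- kernel of the transpose = multiples of `ε`
  have hkerT : LinearMap.ker Mᵀ.mulVecLin = Submodule.span ℝ {ε} := by
    ext g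
    rw [LinearMap.mem_ker, Matrix.mulVecLin_apply, Submodule.mem_span_singleton]
    constructor
    · intro hg
      -- `g` alternates along edges
      have halt : ∀ v w, (edGraph ed).Adj v w → g v = -g w := by
        intro v w hvw
        obtain ⟨hne, l, hl⟩ := edGraph_adj_iff.1 hvw
        have := congrFun hg l
        rw [hM, transpose_incidence_mulVec hne hl, Pi.zero_apply] at this
        linarith
      obtain ⟨v₀⟩ := hconn.nonempty
      refine ⟨g v₀ / ε v₀, funext fun v => ?_⟩
      rw [Pi.smul_apply, smul_eq_mul]
      have := ker_transpose_walk hε halt (Classical.choice (hconn.preconnected v₀ v))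
      rw [div_mul_eq_mul_div, div_eq_iff (hε0 v₀)]
      exact this.symm
    · rintro ⟨a, rfl⟩
      funext l
      obtain ⟨x, y, hxy, hl⟩ := exists_eq_mk_of_not_isDiag (hnd l)
      rw [hM, transpose_incidence_mulVec hxy hl, Pi.zero_apply, Pi.smul_apply, Pi.smul_apply, smul_eq_mul,
        smul_eq_mul, hε x y (edGraph_adj_iff.2 ⟨hxy, l, hl⟩)]
      ring
  obtain ⟨v₀⟩ := hconn.nonempty
  have hε_ne : ε ≠ 0 := fun h => hε0 v₀ (by rw [h]; rfl)
  have hrankT : Mᵀ.rank + 1 = Fintype.card V := by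
    have h := LinearMap.finrank_range_add_finrank_ker Mᵀ.mulVecLin
    rw [hkerT, finrank_span_singleton hε_ne, Module.finrank_fintype_fun_eq_card] at h
    exact h
  have hrank : M.rank + finrank ℝ (flatBand (univ : Finset V) (incVec ed)) = Fintype.card Λ := by
    have h := LinearMap.finrank_range_add_finrank_ker M.mulVecLin
    rw [Module.finrank_fintype_fun_eq_card, ← flatBand_incVec_eq_ker] at h
    exact h
  rw [Matrix.rank_transpose] at hrankT
  omega

end LineGraph

end FlatBand

end Literature.MathematicalPhysics.QuantumLattice
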